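import Summits.Ventures.LatticeQCDFlow.Exactness.ReversibleVariationalSup
import HarnessLib

/-!
# The variational CEILING without a summability hypothesis: `(∫ g v w)² ≤ B·𝓔(v)` for all trial `v` forces `Σ_{k<N} C(k) ≤ B` for a positive sampler

HONEST FRAMING: exact (Metropolis-corrected) sampling algorithms for lattice gauge theory;
figures of merit are autocorrelation/cost numbers at stated couplings and volumes; no
continuum-physics claim.  (SCALAR calibration rung S0-A: not a gauge result.)

Venture `LatticeQCDFlow` (cell pub-lqcd), topic `Exactness`; FANOUT row 2 (`s0-phi4`).  NEW WORK
of the cell over `Exactness/ReversibleVariationalSup.lean` (partial Neumann sums `S_N = Σ_{k<N} rᵏ Kᵏ g`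
on an admissible class, `neumann_quadForm_eq`, `abelSum_le_of_forall_sq_inner_le`) and
`Exactness/ReversibleOperatorL2.lean` (Cauchy–Schwarz on the class).  Elementary real analysis only;
nothing is cited as a fact.  Printed counterparts NAMED ONLY: Kipnis–Varadhan 1986 and
Caracciolo–Pelissetto–Sokal 1990 (the `H₋₁` variational formula for the asymptotic variance of a
reversible chain: `σ²(g) = sup_v [2⟨g,v⟩ − 𝓔(v)]`).

## Why this file (row 2's leftover (α⁹) at the FORMAT level)

The tree has two least-constant theorems for the Green–Kubo sum `Σ_k C_g(k)` of a reversible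
sampler: `tsum_le_of_forall_sq_inner_le_dirichlet` (`ReversibleVariationalSupTauInt`), which ASSUMES
the series summable, and `tauInt_le_of_poincare_of_nonneg` (`ReversiblePoincareCeilingPositive`),
which needs a POINCARÉ inequality `γ ∫u²w ≤ 𝓔(u)` — a spectral gap.  The acceptance-weighted
ceiling of the flow arm (Deligiannidis–Lee shape, `τ_int(g) ≤ E_{g²}[1/ρ]/ā − ½`) is neither: its
input is a variational bound `(∫ g v w)² ≤ B_g · 𝓔(v)` whose constant depends on the observable and
which is NOT a spectral gap.  Here: for a sampler with NONNEGATIVE autocovariances (a positive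
operator — the exact flow sampler on all of `L²(e^{−S})`, `FlowSamplerSquareIntegrableMonotone`;
every second step of any reversible sampler, `ReversibleTwoStep`) such a bound caps EVERY PARTIAL
SUM `Σ_{k<N} C_g(k) ≤ B_g`, hence the series is summable with `Σ_k C_g(k) ≤ B_g` and
`τ_int(g) ≤ B_g/C_g(0) − ½` — no a-priori summability, no Poincaré inequality, no boundedness of
`g` (the class is abstract).  For an ARBITRARY reversible sampler the same bound caps every Abel sum
by `max(C_g(0), B_g)` unconditionally.

## What is proved (namespace `RevOp`; `g ∈ A`, `C(k) = ∫ g (Kᵏ g) w`, `P = C(0)`,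
`𝓔(v) = ∫ v² w − ∫ v (K v) w`; hypothesis (var): `0 ≤ B` and `(∫ g v w)² ≤ B · 𝓔(v)` for all `v ∈ A`)

* `neumann_dirichlet_eq` — `𝓔(S_N) = Σ_{k<N} C(k) − Σ_{k<N} C(N+k)` for `S_N = Σ_{k<N} Kᵏ g`;
* **`sum_range_autocov_le_of_forall_sq_inner_le_dirichlet`** — (var) and `C(k) ≥ 0` for all `k` ⇒
  `Σ_{k<N} C(k) ≤ B` for EVERY `N` (test (var) at `v = S_N`: `T_N² ≤ B·𝓔(S_N) ≤ B·T_N`);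
* **`summable_autocov_of_forall_sq_inner_le_dirichlet`** — hence `C` summable and `Σ_k C(k) ≤ B`;
* **`tauInt_le_of_forall_sq_inner_le_dirichlet_of_nonneg`** — with `P > 0`: the normalised series is
  summable and **`τ_int(g) ≤ B/P − ½`** (`Scoring.tauInt`);
* **`abelSum_le_max_of_forall_sq_inner_le_dirichlet`** — for ANY reversible sampler (no positivity),
  (var) ⇒ `Σ_k C(k) rᵏ ≤ max(P, B)` for every `0 ≤ r < 1` (so, by the tree's Abel dichotomy
  `ReversibleAbelFloors`, either the series is not summable or `τ_int + ½ ≤ max(P, B)/P`).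

The flow arm's acceptance-weighted ceiling on `L²(e^{−S})` — the magnetisation included — is the
instance `FlowSamplerSquareIntegrableAcceptanceCeiling.lean`.
NOT CLAIMED: a variational bound for any particular sampler (hypothesis); positivity for the HMC or
local window-Metropolis arms (false in general); any number for any run.
-/

namespace Summit.Ventures.LatticeQCDFlow.Exactness

open Real MeasureTheory Filter Finset Topology
open Summit.Ventures.LatticeQCDFlow.Scoring

namespace RevOp

variable {X : Type*} [MeasurableSpace X] {μ : Measure X} {w : X → ℝ} {A : (X → ℝ) → Prop}
  {K : (X → ℝ) → (X → ℝ)}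

/-! ## §1 The Dirichlet form of a partial Neumann sum -/

/-- **`𝓔(S_N) = Σ_{k<N} C(k) − Σ_{k<N} C(N+k)`** for the partial Neumann sum `S_N = Σ_{k<N} 1ᵏ Kᵏ g`
(the tree's `neumann_quadForm_eq` at `r = 1`). -/
theorem neumann_dirichlet_eq
    (hAi : ∀ ⦃f h : X → ℝ⦄, A f → A h → Integrable (fun x => f x * h x * w x) μ)
    (hAc : ∀ ⦃f h : X → ℝ⦄ (c : ℝ), A f → A h → A (fun x => f x + c * h x))
    (hAK : ∀ ⦃f : X → ℝ⦄, A f → A (K f))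
    (hlin : ∀ ⦃f h : X → ℝ⦄ (c : ℝ), A f → A h →
      ∀ x, K (fun s => f s + c * h s) x = K f x + c * K h x)
    (hsymm : ∀ ⦃f h : X → ℝ⦄, A f → A h →
      ∫ x, K f x * h x * w x ∂μ = ∫ x, f x * K h x * w x ∂μ)
    {g : X → ℝ} (hg : A g) (N : ℕ) :
    (∫ x, (∑ k ∈ Finset.range N, (1 : ℝ) ^ k * (K^[k] g) x) ^ 2 * w x ∂μ)
        - ∫ x, (∑ k ∈ Finset.range N, (1 : ℝ) ^ k * (K^[k] g) x)
          * K (fun y => ∑ k ∈ Finset.range N, (1 : ℝ) ^ k * (K^[k] g) y) x * w x ∂μ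
      = (∑ k ∈ Finset.range N, ∫ x, g x * (K^[k] g) x * w x ∂μ)
        - ∑ k ∈ Finset.range N, ∫ x, g x * (K^[N + k] g) x * w x ∂μ := by
  have h := neumann_quadForm_eq hAi hAc hAK hlin hsymm hg 1 N
  simp only [one_pow, one_mul, mul_one] at h ⊢
  exact h

/-! ## §2 Positive samplers: every partial sum is capped, so the series is summable -/

/-- **EVERY PARTIAL GREEN–KUBO SUM IS CAPPED BY THE VARIATIONAL CONSTANT.**  `RevOp` format;
`g ∈ A` with `C_g(k) ≥ 0` for all `k` (a positive sampler); `0 ≤ B` with `(∫ g v w)² ≤ B·𝓔(v)` for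
every `v ∈ A`.  Then `Σ_{k<N} C_g(k) ≤ B` for every `N` — no summability assumed. -/
theorem sum_range_autocov_le_of_forall_sq_inner_le_dirichlet
    (hAi : ∀ ⦃f h : X → ℝ⦄, A f → A h → Integrable (fun x => f x * h x * w x) μ)
    (hAc : ∀ ⦃f h : X → ℝ⦄ (c : ℝ), A f → A h → A (fun x => f x + c * h x))
    (hAK : ∀ ⦃f : X → ℝ⦄, A f → A (K f))
    (hlin : ∀ ⦃f h : X → ℝ⦄ (c : ℝ), A f → A h →
      ∀ x, K (fun s => f s + c * h s) x = K f x + c * K h x)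
    (hsymm : ∀ ⦃f h : X → ℝ⦄, A f → A h →
      ∫ x, K f x * h x * w x ∂μ = ∫ x, f x * K h x * w x ∂μ)
    {g : X → ℝ} (hg : A g) (hpos : ∀ k, 0 ≤ ∫ x, g x * (K^[k] g) x * w x ∂μ)
    {B : ℝ} (hB : 0 ≤ B)
    (h : ∀ ⦃v : X → ℝ⦄, A v → (∫ x, g x * v x * w x ∂μ) ^ 2
        ≤ B * ((∫ x, v x ^ 2 * w x ∂μ) - ∫ x, v x * K v x * w x ∂μ)) (N : ℕ) :
    ∑ k ∈ Finset.range N, ∫ x, g x * (K^[k] g) x * w x ∂μ ≤ B := by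
  set C : ℕ → ℝ := fun k => ∫ x, g x * (K^[k] g) x * w x ∂μ with hC
  set T := ∑ k ∈ Finset.range N, C k with hT
  -- test the variational bound at `v = S_N`
  have hstep := h (neumann_mem hAc hAK hg 1 N)
  have hinner : ∫ x, g x * (∑ k ∈ Finset.range N, (1 : ℝ) ^ k * (K^[k] g) x) * w x ∂μ = T := by
    rw [integral_mul_neumann hAi hAK hg 1 N]
    simp only [one_pow, mul_one, hT, hC]
  rw [hinner, neumann_dirichlet_eq hAi hAc hAK hlin hsymm hg N] at hstep
  -- `𝓔(S_N) ≤ T` since the shifted block is nonnegative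
  have hshift : 0 ≤ ∑ k ∈ Finset.range N, C (N + k) := Finset.sum_nonneg fun k _ => hpos (N + k)
  have hT0 : 0 ≤ T := Finset.sum_nonneg fun k _ => hpos k
  have hT2 : T ^ 2 ≤ B * T := by
    calc T ^ 2 ≤ B * (T - ∑ k ∈ Finset.range N, C (N + k)) := hstep
      _ ≤ B * T := mul_le_mul_of_nonneg_left (by linarith) hB
  rcases eq_or_lt_of_le hT0 with hz | hgt
  · rw [← hz]; exact hB
  · nlinarith

/-- **SUMMABILITY AND THE CAP `Σ_k C_g(k) ≤ B`** for a positive sampler under the variational bound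
(bounded partial sums of a nonnegative series). -/
theorem summable_autocov_of_forall_sq_inner_le_dirichlet
    (hAi : ∀ ⦃f h : X → ℝ⦄, A f → A h → Integrable (fun x => f x * h x * w x) μ)
    (hAc : ∀ ⦃f h : X → ℝ⦄ (c : ℝ), A f → A h → A (fun x => f x + c * h x))
    (hAK : ∀ ⦃f : X → ℝ⦄, A f → A (K f))
    (hlin : ∀ ⦃f h : X → ℝ⦄ (c : ℝ), A f → A h →
      ∀ x, K (fun s => f s + c * h s) x = K f x + c * K h x)
    (hsymm : ∀ ⦃f h : X → ℝ⦄, A f → A h →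
      ∫ x, K f x * h x * w x ∂μ = ∫ x, f x * K h x * w x ∂μ)
    {g : X → ℝ} (hg : A g) (hpos : ∀ k, 0 ≤ ∫ x, g x * (K^[k] g) x * w x ∂μ)
    {B : ℝ} (hB : 0 ≤ B)
    (h : ∀ ⦃v : X → ℝ⦄, A v → (∫ x, g x * v x * w x ∂μ) ^ 2
        ≤ B * ((∫ x, v x ^ 2 * w x ∂μ) - ∫ x, v x * K v x * w x ∂μ)) :
    (Summable fun k => ∫ x, g x * (K^[k] g) x * w x ∂μ) ∧
    ∑' k, ∫ x, g x * (K^[k] g) x * w x ∂μ ≤ B := by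
  have hpart := sum_range_autocov_le_of_forall_sq_inner_le_dirichlet hAi hAc hAK hlin hsymm hg hpos
    hB h
  exact ⟨summable_of_sum_range_le hpos hpart, tsum_le_of_sum_range_le hpos hpart⟩

/-- **THE VARIATIONAL CEILING FOR `τ_int`, NO SUMMABILITY HYPOTHESIS.**  `RevOp` format; `g ∈ A`
with `P = C_g(0) > 0` and `C_g(k) ≥ 0` for all `k`; `0 ≤ B` with `(∫ g v w)² ≤ B·𝓔(v)` for every
`v ∈ A`.  Then the normalised autocorrelation series of `g` IS summable and **`τ_int(g) ≤ B/P − ½`**. -/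
theorem tauInt_le_of_forall_sq_inner_le_dirichlet_of_nonneg
    (hAi : ∀ ⦃f h : X → ℝ⦄, A f → A h → Integrable (fun x => f x * h x * w x) μ)
    (hAc : ∀ ⦃f h : X → ℝ⦄ (c : ℝ), A f → A h → A (fun x => f x + c * h x))
    (hAK : ∀ ⦃f : X → ℝ⦄, A f → A (K f))
    (hlin : ∀ ⦃f h : X → ℝ⦄ (c : ℝ), A f → A h →
      ∀ x, K (fun s => f s + c * h s) x = K f x + c * K h x)
    (hsymm : ∀ ⦃f h : X → ℝ⦄, A f → A h →
      ∫ x, K f x * h x * w x ∂μ = ∫ x, f x * K h x * w x ∂μ)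
    {g : X → ℝ} (hg : A g) (hP : 0 < ∫ x, g x ^ 2 * w x ∂μ)
    (hpos : ∀ k, 0 ≤ ∫ x, g x * (K^[k] g) x * w x ∂μ)
    {B : ℝ} (hB : 0 ≤ B)
    (h : ∀ ⦃v : X → ℝ⦄, A v → (∫ x, g x * v x * w x ∂μ) ^ 2
        ≤ B * ((∫ x, v x ^ 2 * w x ∂μ) - ∫ x, v x * K v x * w x ∂μ)) :
    (Summable fun n => (∫ x, g x * (K^[n + 1] g) x * w x ∂μ) / ∫ x, g x ^ 2 * w x ∂μ) ∧
    tauInt (fun n => (∫ x, g x * (K^[n] g) x * w x ∂μ) / ∫ x, g x ^ 2 * w x ∂μ)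
      ≤ B / (∫ x, g x ^ 2 * w x ∂μ) - 1 / 2 := by
  set C : ℕ → ℝ := fun k => ∫ x, g x * (K^[k] g) x * w x ∂μ with hC
  set P := ∫ x, g x ^ 2 * w x ∂μ with hPdef
  obtain ⟨hS, hle⟩ := summable_autocov_of_forall_sq_inner_le_dirichlet hAi hAc hAK hlin hsymm hg
    hpos hB h
  have hsρ : Summable fun k => C k / P := hS.div_const P
  have hs : Summable fun n => C (n + 1) / P := (summable_nat_add_iff 1).2 hsρ
  have hC0 : C 0 = P := by
    simp only [hC, hPdef, Function.iterate_zero, id_eq]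
    exact integral_congr_ae (Eventually.of_forall fun x => by ring)
  refine ⟨hs, ?_⟩
  have h1 : (∑' k, C k) / P = tauInt (fun n => C n / P) + 1 / 2 := by
    rw [← tsum_div_const, hsρ.tsum_eq_zero_add, hC0, div_self hP.ne']
    simp only [tauInt]
    ring
  have h2 : (∑' k, C k) / P ≤ B / P := div_le_div_of_nonneg_right hle hP.le
  linarith

/-! ## §3 Any reversible sampler: the Abel sums are capped unconditionally -/

/-- **THE VARIATIONAL CAP IN ABEL FORM, for ANY reversible sampler** (no positivity, no
summability): if `(∫ g v w)² ≤ B·𝓔(v)` for every `v ∈ A` (any real `B`), then for every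
`0 ≤ r < 1`:  `Σ_k C_g(k) rᵏ ≤ max(C_g(0), B)`  (split `(∫ g v w)² = (1−r)(∫ g v w)² + r(∫ g v w)²`, Cauchy–Schwarz
on the first part and the hypothesis on the second: the bound is against `Q_r(v) = ∫v²w − r∫v(Kv)w`). -/
theorem abelSum_le_max_of_forall_sq_inner_le_dirichlet (hw0 : ∀ x, 0 ≤ w x)
    (hAi : ∀ ⦃f h : X → ℝ⦄, A f → A h → Integrable (fun x => f x * h x * w x) μ)
    (hAc : ∀ ⦃f h : X → ℝ⦄ (c : ℝ), A f → A h → A (fun x => f x + c * h x))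
    (hAK : ∀ ⦃f : X → ℝ⦄, A f → A (K f))
    (hlin : ∀ ⦃f h : X → ℝ⦄ (c : ℝ), A f → A h →
      ∀ x, K (fun s => f s + c * h s) x = K f x + c * K h x)
    (hsymm : ∀ ⦃f h : X → ℝ⦄, A f → A h →
      ∫ x, K f x * h x * w x ∂μ = ∫ x, f x * K h x * w x ∂μ)
    (hcontr : ∀ ⦃f : X → ℝ⦄, A f → ∫ x, K f x ^ 2 * w x ∂μ ≤ ∫ x, f x ^ 2 * w x ∂μ)
    {g : X → ℝ} (hg : A g) {B : ℝ}
    (h : ∀ ⦃v : X → ℝ⦄, A v → (∫ x, g x * v x * w x ∂μ) ^ 2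
        ≤ B * ((∫ x, v x ^ 2 * w x ∂μ) - ∫ x, v x * K v x * w x ∂μ))
    {r : ℝ} (hr0 : 0 ≤ r) (hr1 : r < 1) :
    ∑' k, (∫ x, g x * (K^[k] g) x * w x ∂μ) * r ^ k ≤ max (∫ x, g x ^ 2 * w x ∂μ) B := by
  set P := ∫ x, g x ^ 2 * w x ∂μ with hPdef
  have hP0 : 0 ≤ P := integral_nonneg fun x => mul_nonneg (sq_nonneg _) (hw0 x)
  set M := max P B with hM
  have hM0 : 0 ≤ M := hP0.trans (le_max_left _ _)
  refine abelSum_le_of_forall_sq_inner_le hw0 hAi hAc hAK hlin hsymm hcontr hg hr0 hr1 hM0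
    fun v hv => ?_
  set I := ∫ x, g x * v x * w x ∂μ with hI
  set V := ∫ x, v x ^ 2 * w x ∂μ with hV
  set E := V - ∫ x, v x * K v x * w x ∂μ with hE
  -- Cauchy–Schwarz: `I² ≤ P V`; hypothesis: `I² ≤ B E`; `E ≥ 0` (contraction + Cauchy–Schwarz)
  have hCS : I ^ 2 ≤ P * V := sq_integral_mul_le hw0 hAi hg hv
  have hvar : I ^ 2 ≤ B * E := h hv
  have hV0 : 0 ≤ V := integral_nonneg fun x => mul_nonneg (sq_nonneg _) (hw0 x)
  have hE0 : 0 ≤ E := by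
    have hKv := hAK hv
    have h1 : (∫ x, v x * K v x * w x ∂μ) ^ 2 ≤ V * ∫ x, K v x ^ 2 * w x ∂μ :=
      sq_integral_mul_le hw0 hAi hv hKv
    have h2 : ∫ x, K v x ^ 2 * w x ∂μ ≤ V := hcontr hv
    have h3 : (∫ x, v x * K v x * w x ∂μ) ^ 2 ≤ V * V :=
      h1.trans (mul_le_mul_of_nonneg_left h2 hV0)
    have h4 : ∫ x, v x * K v x * w x ∂μ ≤ V := by
      by_contra hc
      rw [not_le] at hc
      nlinarith
    rw [hE]; linarith
  have e : V - r * ∫ x, v x * K v x * w x ∂μ = (1 - r) * V + r * E := by rw [hE]; ring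
  rw [e]
  have h1 : (1 - r) * I ^ 2 ≤ (1 - r) * (M * V) :=
    mul_le_mul_of_nonneg_left (hCS.trans (mul_le_mul_of_nonneg_right (le_max_left _ _) hV0))
      (by linarith)
  have h2 : r * I ^ 2 ≤ r * (M * E) :=
    mul_le_mul_of_nonneg_left (hvar.trans (mul_le_mul_of_nonneg_right (le_max_right _ _) hE0)) hr0
  calc I ^ 2 = (1 - r) * I ^ 2 + r * I ^ 2 := by ring
    _ ≤ (1 - r) * (M * V) + r * (M * E) := add_le_add h1 h2
    _ = M * ((1 - r) * V + r * E) := by ring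

end RevOp

end Summit.Ventures.LatticeQCDFlow.Exactness
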